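import Mathlib.Algebra.MvPolynomial.Derivation
import Mathlib.Algebra.MvPolynomial.Funext
import Mathlib.Algebra.MvPolynomial.Monad
import Mathlib.Data.Matrix.Block
import Mathlib.LinearAlgebra.Matrix.Determinant.Basic
import Mathlib.RingTheory.Derivation.Lie
import Literature.NumberTheory.Automorphic.HarishChandraGL
import HarnessLib

/-!
# Uniqueness of the Harish-Chandra homomorphism for `𝔤𝔩ₙ(𝕜)`: proof

Topic `Literature/NumberTheory/Automorphic`. Sorry-free discharge of the named fact
`Literature.NumberTheory.Automorphic.harishChandraHomGL_unique` (`HarishChandraGL.lean`): any two Harish-Chandra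
homomorphisms `γ₁ γ₂ : HarishChandraHomGL 𝕜 n` (`𝕜 = ℝ` or `ℂ`, i.e. `[RCLike 𝕜]`) are equal.
A. W. Knapp, *Lie Groups Beyond an Introduction*, 2nd ed., Progress in Mathematics 140,
Birkhäuser 2002, Ch. V §5, Theorem 5.44 (the Harish-Chandra isomorphism
`γ : Z(𝔤_ℂ) ≃ S(𝔥_ℂ)^W`, characterised by the action of `Z(𝔤_ℂ)` on highest weight vectors,
Knapp (5.43) / Lemma 5.42) together with §V.3 (Verma modules of arbitrary highest weight);
cf. J. E. Humphreys, *Introduction to Lie Algebras and Representation Theory*, GTM 9,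
Springer 1972, §23.3.

## The statement (as vendored)

`HarishChandraHomGL 𝕜 n` bundles a real algebra map `γ : Z(𝔤) →ₐ[ℝ] ℂ[x_{τ,i}]`
(`𝔤 = 𝔤𝔩ₙ(𝕜)` as a real Lie algebra, `Z(𝔤)` the centre of its real enveloping algebra,
`τ : 𝕜 →ₐ[ℝ] ℂ`, `i : Fin n`) with two properties: `τ`-wise symmetry of the values, and the
*highest weight axiom*: for every complex vector space `V : Type`, every real Lie algebra
representation `ρ : 𝔤 →ₗ⁅ℝ⁆ End_ℂ(V)` and every highest weight vector `v ∈ V` of weight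
`λ : (𝕜 →ₐ[ℝ] ℂ) → Fin n → ℂ` (`v ≠ 0`, `𝔫 v = 0`, `diag(h) v = (∑_{τ,i} λ_{τ,i} τ(h_i)) v`), every
`z ∈ Z(𝔤)` acts on `v` by the scalar `γ(z)(λ + ρ)`. The fact `harishChandraHomGL_unique` says
`∀ γ₁ γ₂ : HarishChandraHomGL 𝕜 n, γ₁ = γ₂`.

## The proof, as formalised

Knapp proves uniqueness by evaluating on the highest weight vectors of the Verma modules
`V(λ)`, `λ ∈ 𝔥_ℂ^*` arbitrary (§V.3, built on Poincaré–Birkhoff–Witt), so that `γ(z)` is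
determined at *every* point of `𝔥_ℂ^*`. Neither PBW nor Verma modules are available here; we
replace them by an explicit family of finite-dimensional-type modules whose highest weights are
Zariski dense, which suffices since `γ(z)` is a polynomial:

1. *The polynomial model* (`glPolyDerivation`, `glPolyRep`). For a commutative ring `K` and a
   finite index type `ι`, `𝔤𝔩_ι(K)` acts on the coordinate ring `K[x_pq : p, q ∈ ι]` of `ι × ι`
   matrices by the derivations `D_Y (x_pq) = (x · Y)_pq` (infinitesimal right translation);
   `Y ↦ D_Y` is a Lie algebra homomorphism (`glPolyDerivation_lie`).
2. *Semi-invariants* (`glPolyDerivation_principalMinor`). If `Y` stabilises the coordinate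
   subspace spanned by `S ⊆ ι` then `D_Y Δ_S = (∑_{s ∈ S} Y_ss) Δ_S` for the principal minor
   `Δ_S = det (x_ab)_{a,b ∈ S}` (derivative of a determinant column by column, `derivation_det`).
   Hence a product `f = ∏_j Δ_{S_j}^{c_j}` (`hwPolyVec`) is a joint eigenvector of all such `D_Y`
   with eigenvalue `∑_j c_j ∑_{s ∈ S_j} Y_ss` (`glPolyDerivation_hwPolyVec`), and `f ≠ 0`
   (its value at the identity matrix is `1`, `hwPolyVec_ne_zero`).
3. *Assembly* (`blockEmbed`, `blockPolyRep`, `isHighestWeightVector_hwPoly`). Enumerate the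
   embeddings by `e : (𝕜 →ₐ[ℝ] ℂ) ≃ Fin m` and let `𝔤𝔩ₙ(𝕜)` act on `ℂ[x_pq : p, q ∈ Fin n × Fin m]`
   through the block-diagonal real algebra embedding `X ↦ diag(τ₀(X), …, τ_{m-1}(X))` into
   `𝔤𝔩_{nm}(ℂ)` followed by the polynomial model. With `S (k, t) = {(a, t) : a ≤ k}`, strictly
   upper triangular `X` kill `f_c = ∏_{(k,t)} Δ_{S(k,t)}^{c(k,t)}` and `diag(h)` acts on it by
   `∑_{τ,i} λ_{τ,i} τ(h_i)` with `λ_{τ,i} = ∑_{k ≥ i} c(k, e τ)`: `f_c` is a highest weight vector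
   of weight `λ_c`, in a module `V : Type` as the axiom (H9) demands.
4. *Density* (`eq_zero_of_forall_aeval_hwWeight`). By the highest weight axiom for `γ₁` and
   `γ₂` on `f_c`, `p = γ₁(z) - γ₂(z)` vanishes at `λ_c + ρ` for all `c : Fin n × Fin m → ℕ`
   (`f_c ≠ 0` and `ℂ[x]` is torsion free). Pull `p` back along the affine substitution
   `x_{τ,i} ↦ ∑_{k ≥ i} y_{(k, e τ)} + ρ_i`: the result vanishes on `ℕ^{Fin n × Fin m}`, hence is
   zero (`mvPolynomial_eq_zero_of_forall_eval_natCast`, from `MvPolynomial.funext_set`); the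
   substitution is surjective on `ℂ`-points (every vector is a vector of tail sums,
   `exists_eq_sum_ite_le`), so `p` vanishes on `ℂ^{(𝕜 →ₐ[ℝ] ℂ) × Fin n}` and `p = 0`
   (`MvPolynomial.funext`).
5. `γ₁ = γ₂` (`harishChandraHomGL_unique_holds`): the two remaining fields are propositions.

## Main results

* `harishChandraHomGL_unique_holds : harishChandraHomGL_unique` (Knapp 2002, Thm. 5.44).

Tools of independent interest (all `[folklore]`): the Leibniz rule for finite products and the
column expansion of `D (det M)` for a derivation `D` (`derivation_finset_prod`,
`derivation_det`), the polynomial model `glPolyRep : 𝔤𝔩_ι(K) →ₗ⁅K⁆ Der K[x_pq]` with the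
semi-invariance of principal minors, and the vanishing criterion
`mvPolynomial_eq_zero_of_forall_eval_natCast`.

## References

* A. W. Knapp, *Lie Groups Beyond an Introduction*, 2nd ed., Birkhäuser 2002, §V.3, §V.5
  (Lemma 5.42, (5.43), Theorem 5.44).
* J. E. Humphreys, *Introduction to Lie Algebras and Representation Theory*, Springer 1972, §23.3.
-/

-- Mathlib idiom (Mathlib/Algebra/Lie/OfAssociative.lean): commutator bracket on associative rings
attribute [local instance 100] LieRing.ofAssociativeRing

open scoped Matrix

noncomputable section

namespace Literature.NumberTheory.Automorphic

/-! ## Derivations of products and determinants -/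

section DerivationDet

variable {K : Type*} [CommRing K] {A : Type*} [CommRing A] [Algebra K A]

/-- **Leibniz rule for a finite product**: `D (∏_{i ∈ s} f i) = ∑_{i ∈ s} (∏_{j ∈ s, j ≠ i} f j) · D (f i)`.
[folklore] -/
theorem derivation_finset_prod {ι : Type*} [DecidableEq ι] (D : Derivation K A A) (s : Finset ι)
    (f : ι → A) : D (∏ i ∈ s, f i) = ∑ i ∈ s, (∏ j ∈ s.erase i, f j) * D (f i) := by
  induction s using Finset.induction_on with
  | empty => simp
  | insert a s ha ih =>
    rw [Finset.prod_insert ha, Derivation.leibniz, ih, Finset.sum_insert ha,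
      Finset.erase_insert ha, smul_eq_mul, smul_eq_mul, add_comm, Finset.mul_sum]
    congr 1
    refine Finset.sum_congr rfl fun i hi => ?_
    rw [Finset.erase_insert_of_ne (by rintro rfl; exact ha hi),
      Finset.prod_insert (fun h => ha (Finset.mem_of_mem_erase h)), mul_assoc]

/-- A derivation on a power of a *semi-invariant*: if `D a = χ • a` then
`D (a ^ k) = (k χ) • a ^ k`. [folklore] -/
theorem derivation_pow_of_eq_smul (D : Derivation K A A) {a : A} {χ : K} (h : D a = χ • a)
    (k : ℕ) : D (a ^ k) = (k • χ) • a ^ k := by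
  induction k with
  | zero => simp
  | succ k ih =>
    rw [pow_succ, Derivation.leibniz, ih, h, succ_nsmul]
    simp only [smul_eq_mul, Algebra.smul_def, map_add]
    ring

/-- A derivation on a product of powers of semi-invariants: if `D (F j) = χ j • F j` for all `j`,
then `D (∏_j F j ^ c j) = (∑_j c j χ j) • ∏_j F j ^ c j`. [folklore] -/
theorem derivation_prod_pow_of_eq_smul {J : Type*} [Fintype J] [DecidableEq J]
    (D : Derivation K A A) (F : J → A) (χ : J → K) (c : J → ℕ) (h : ∀ j, D (F j) = χ j • F j) :
    D (∏ j, F j ^ c j) = (∑ j, c j • χ j) • ∏ j, F j ^ c j := by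
  rw [derivation_finset_prod, Finset.sum_smul]
  refine Finset.sum_congr rfl fun j _ => ?_
  rw [derivation_pow_of_eq_smul D (h j), Algebra.mul_smul_comm,
    Finset.prod_erase_mul _ _ (Finset.mem_univ j)]

/-- **Derivative of a determinant, column by column**: for a derivation `D` and a square matrix
`M`, `D (det M) = ∑_j det (M with its `j`-th column replaced by `D` of that column)`. [folklore] -/
theorem derivation_det {m : Type*} [Fintype m] [DecidableEq m] (D : Derivation K A A)
    (M : Matrix m m A) : D M.det = ∑ j, (M.updateCol j fun i => D (M i j)).det := by
  simp only [Matrix.det_apply, map_sum, Units.smul_def, map_zsmul, derivation_finset_prod,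
    Finset.smul_sum]
  rw [Finset.sum_comm]
  refine Finset.sum_congr rfl fun j _ => Finset.sum_congr rfl fun σ _ => ?_
  congr 1
  refine Eq.trans ?_ (Finset.prod_erase_mul Finset.univ _ (Finset.mem_univ j))
  simp only [Matrix.updateCol_self]
  congr 1
  exact Finset.prod_congr rfl fun i hi => by
    simp only [Matrix.updateCol_ne (Finset.ne_of_mem_erase hi)]

end DerivationDet

/-! ## The polynomial model: `𝔤𝔩_ι(K)` acting on `K[x_pq]` by derivations -/

section PolyModel

variable (K : Type*) [CommRing K] (ι : Type*) [Fintype ι]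

/-- The derivation `D_Y` of the coordinate ring `K[x_pq : p, q ∈ ι]` of `ι × ι` matrices given on
generators by `D_Y (x_pq) = (x · Y)_pq = ∑_r Y_rq x_pr`: the infinitesimal right translation by
`Y ∈ 𝔤𝔩_ι(K)` of polynomial functions on `ι × ι` matrices, `(D_Y f)(x) = d/dt f(x (1 + tY))|_{t=0}`.
[folklore] -/
def glPolyDerivation (Y : Matrix ι ι K) :
    Derivation K (MvPolynomial (ι × ι) K) (MvPolynomial (ι × ι) K) :=
  MvPolynomial.mkDerivation K fun pq => ∑ r, Y r pq.2 • MvPolynomial.X (pq.1, r)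

variable {K ι}

/-- `D_Y (x_pq) = ∑_r Y_rq x_pr`. [folklore] -/
@[simp]
theorem glPolyDerivation_X (Y : Matrix ι ι K) (p q : ι) :
    glPolyDerivation K ι Y (MvPolynomial.X (p, q)) = ∑ r, Y r q • MvPolynomial.X (p, r) := by
  simp [glPolyDerivation]

/-- `Y ↦ D_Y` is additive. [folklore] -/
theorem glPolyDerivation_add (Y Y' : Matrix ι ι K) :
    glPolyDerivation K ι (Y + Y') = glPolyDerivation K ι Y + glPolyDerivation K ι Y' := by
  refine MvPolynomial.derivation_ext fun ⟨p, q⟩ => ?_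
  simp [Finset.sum_add_distrib, add_smul]

/-- `Y ↦ D_Y` is `K`-homogeneous. [folklore] -/
theorem glPolyDerivation_smul (a : K) (Y : Matrix ι ι K) :
    glPolyDerivation K ι (a • Y) = a • glPolyDerivation K ι Y := by
  refine MvPolynomial.derivation_ext fun ⟨p, q⟩ => ?_
  simp [Finset.smul_sum, smul_smul]

/-- `D_Y (D_{Y'} (x_pq)) = ∑_r (Y Y')_rq x_pr = ∑_r ∑_s Y_rs Y'_sq x_pr`. [folklore] -/
theorem glPolyDerivation_apply_X_X (Y Y' : Matrix ι ι K) (p q : ι) :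
    glPolyDerivation K ι Y (glPolyDerivation K ι Y' (MvPolynomial.X (p, q))) =
      ∑ r, ∑ s, (Y r s * Y' s q) • MvPolynomial.X (R := K) (p, r) := by
  rw [glPolyDerivation_X, map_sum]
  simp_rw [Derivation.map_smul, glPolyDerivation_X, Finset.smul_sum, smul_smul]
  rw [Finset.sum_comm]
  exact Finset.sum_congr rfl fun r _ => Finset.sum_congr rfl fun s _ => by rw [mul_comm]

variable [DecidableEq ι]

/-- `Y ↦ D_Y` is a Lie algebra homomorphism for the commutator bracket on `𝔤𝔩_ι(K)` and on
derivations: `D_⁅Y, Y'⁆ = ⁅D_Y, D_Y'⁆` (both sides are derivations, so it suffices to compare them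
on the generators `x_pq`). [folklore] -/
theorem glPolyDerivation_lie (Y Y' : Matrix ι ι K) :
    glPolyDerivation K ι ⁅Y, Y'⁆ = ⁅glPolyDerivation K ι Y, glPolyDerivation K ι Y'⁆ := by
  refine MvPolynomial.derivation_ext fun ⟨p, q⟩ => ?_
  rw [Derivation.commutator_apply, glPolyDerivation_apply_X_X, glPolyDerivation_apply_X_X,
    glPolyDerivation_X, ← Finset.sum_sub_distrib]
  refine Finset.sum_congr rfl fun r _ => ?_
  rw [Ring.lie_def, Matrix.sub_apply, Matrix.mul_apply, Matrix.mul_apply, sub_smul,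
    Finset.sum_smul, Finset.sum_smul]

variable (K ι) in
/-- **The polynomial model of `𝔤𝔩_ι(K)`**: the Lie algebra homomorphism `Y ↦ D_Y` from `𝔤𝔩_ι(K)`
(commutator bracket) to the Lie algebra of derivations of `K[x_pq : p, q ∈ ι]`, i.e. the
differential of the representation of `GL_ι` on polynomial functions on `ι × ι` matrices by right
translation. [folklore] -/
def glPolyRep : Matrix ι ι K →ₗ⁅K⁆
    Derivation K (MvPolynomial (ι × ι) K) (MvPolynomial (ι × ι) K) where
  toFun := glPolyDerivation K ι
  map_add' := glPolyDerivation_add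
  map_smul' := glPolyDerivation_smul
  map_lie' {Y Y'} := glPolyDerivation_lie Y Y'

/-- `glPolyRep K ι Y = D_Y`. [folklore] -/
@[simp]
theorem glPolyRep_apply (Y : Matrix ι ι K) : glPolyRep K ι Y = glPolyDerivation K ι Y := rfl

variable (K ι) in
/-- The principal minor `Δ_S = det (x_ab)_{a, b ∈ S}` of the generic `ι × ι` matrix `(x_pq)`, an
element of `K[x_pq]`. [folklore] -/
def principalMinor (S : Finset ι) : MvPolynomial (ι × ι) K :=
  (Matrix.of fun a b : S => MvPolynomial.X (R := K) ((a : ι), (b : ι))).det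

/-- **Semi-invariance of principal minors.** If `Y ∈ 𝔤𝔩_ι(K)` stabilises the coordinate subspace
spanned by `S` (`Y_rs = 0` for `s ∈ S`, `r ∉ S`), then `D_Y Δ_S = (∑_{s ∈ S} Y_ss) Δ_S`: the
`S`-columns of `x (1 + tY)` are combinations of the `S`-columns of `x`. In particular the leading
principal minors are highest weight vectors for the upper triangular Borel subalgebra acting by
infinitesimal right translation. [folklore] -/
theorem glPolyDerivation_principalMinor (Y : Matrix ι ι K) (S : Finset ι)
    (hY : ∀ s ∈ S, ∀ r ∉ S, Y r s = 0) :
    glPolyDerivation K ι Y (principalMinor K ι S) = (∑ s ∈ S, Y s s) • principalMinor K ι S := by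
  classical
  let M : Matrix S S (MvPolynomial (ι × ι) K) :=
    Matrix.of fun a b : S => MvPolynomial.X (R := K) ((a : ι), (b : ι))
  have key : ∀ i j : S, glPolyDerivation K ι Y (M i j) =
      ∑ b : S, (MvPolynomial.C (Y b j) : MvPolynomial (ι × ι) K) • M i b := by
    intro i j
    simp only [M, Matrix.of_apply, glPolyDerivation_X]
    rw [← Finset.sum_subset (Finset.subset_univ S) fun r _ hr => by rw [hY j j.2 r hr, zero_smul],
      ← Finset.sum_coe_sort S]
    exact Finset.sum_congr rfl fun b _ => by rw [smul_eq_mul, MvPolynomial.smul_eq_C_mul]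
  show glPolyDerivation K ι Y M.det = (∑ s ∈ S, Y s s) • M.det
  rw [derivation_det]
  simp_rw [key, Matrix.det_updateCol_sum]
  rw [← Finset.sum_smul, ← map_sum, ← Finset.sum_coe_sort S (fun s => Y s s), smul_eq_mul,
    MvPolynomial.smul_eq_C_mul]

variable (K ι) in
/-- The candidate highest weight vector `∏_j Δ_{S j} ^ c j`, a product of powers of principal
minors of the generic matrix. [folklore] -/
def hwPolyVec {J : Type*} [Fintype J] (S : J → Finset ι) (c : J → ℕ) : MvPolynomial (ι × ι) K :=
  ∏ j, principalMinor K ι (S j) ^ c j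

/-- `∏_j Δ_{S j} ^ c j` is a joint eigenvector of every `D_Y` with `Y` stabilising all the
coordinate subspaces `S j`, with eigenvalue `∑_j c j · ∑_{s ∈ S j} Y_ss`. [folklore] -/
theorem glPolyDerivation_hwPolyVec {J : Type*} [Fintype J] (S : J → Finset ι) (c : J → ℕ)
    (Y : Matrix ι ι K) (hY : ∀ j, ∀ s ∈ S j, ∀ r ∉ S j, Y r s = 0) :
    glPolyDerivation K ι Y (hwPolyVec K ι S c) =
      (∑ j, c j • ∑ s ∈ S j, Y s s) • hwPolyVec K ι S c := by
  classical
  exact derivation_prod_pow_of_eq_smul _ _ _ c fun j =>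
    glPolyDerivation_principalMinor Y (S j) (hY j)

omit [Fintype ι] in
/-- The principal minors take the value `1` at the identity matrix. [folklore] -/
theorem eval_principalMinor_one (S : Finset ι) :
    MvPolynomial.eval (fun pq : ι × ι => if pq.1 = pq.2 then (1 : K) else 0)
      (principalMinor K ι S) = 1 := by
  rw [principalMinor, RingHom.map_det]
  convert Matrix.det_one (n := S) (R := K)
  ext a b
  rw [RingHom.mapMatrix_apply, Matrix.map_apply, Matrix.of_apply, MvPolynomial.eval_X,
    Matrix.one_apply]
  exact if_congr Subtype.coe_inj rfl rfl

omit [Fintype ι] in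
/-- The candidate highest weight vector `∏_j Δ_{S j} ^ c j` is nonzero over a nontrivial ring
(its value at the identity matrix is `1`). [folklore] -/
theorem hwPolyVec_ne_zero [Nontrivial K] {J : Type*} [Fintype J] (S : J → Finset ι)
    (c : J → ℕ) : hwPolyVec K ι S c ≠ 0 := by
  classical
  intro h
  have := congr_arg
    (MvPolynomial.eval fun pq : ι × ι => if pq.1 = pq.2 then (1 : K) else 0) h
  simp only [hwPolyVec, map_prod, map_pow, eval_principalMinor_one, one_pow,
    Finset.prod_const_one, map_zero] at this
  exact one_ne_zero this

end PolyModel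

/-! ## Assembly: the block-diagonal polynomial model of `𝔤𝔩ₙ(𝕜)` and its highest weight vectors -/

section Assembly

variable (𝕜 : Type*) [RCLike 𝕜] (n m : ℕ)

variable {𝕜} in
/-- A real algebra map `τ : 𝕜 → ℂ` is `ℝ`-linear: `τ (c • x) = c · τ x`. [folklore] -/
theorem algHom_real_smul (τ : 𝕜 →ₐ[ℝ] ℂ) (c : ℝ) (x : 𝕜) : τ (c • x) = (c : ℂ) * τ x := by
  rw [RCLike.real_smul_eq_coe_mul, map_mul]
  exact congrArg (· * τ x) (τ.commutes c)

/-- The block-diagonal embedding `X ↦ diag(τ₀(X), …, τ_{m-1}(X))` of `𝔤𝔩ₙ(𝕜)` into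
`𝔤𝔩_{Fin n × Fin m}(ℂ)` attached to a family `τ` of real algebra embeddings `𝕜 → ℂ` (a real
algebra homomorphism; for `τ` an enumeration of all embeddings this is `𝔤 ↪ 𝔤_ℂ = ∏_τ 𝔤𝔩ₙ(ℂ)`
followed by the diagonal inclusion into `𝔤𝔩_{nm}(ℂ)`, cf. Knapp §VI.1). [folklore] -/
def blockEmbed (τ : Fin m → (𝕜 →ₐ[ℝ] ℂ)) :
    Matrix (Fin n) (Fin n) 𝕜 →ₐ[ℝ] Matrix (Fin n × Fin m) (Fin n × Fin m) ℂ :=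
  AlgHom.mk'
    ((Matrix.blockDiagonalRingHom (Fin n) (Fin m) ℂ).comp
      (RingHom.pi fun j => (τ j).toRingHom.mapMatrix))
    fun c X => by
      ext ⟨i, k⟩ ⟨j, k'⟩
      simp [Matrix.blockDiagonal_apply, algHom_real_smul]

/-- Entries of the block-diagonal embedding: `blockEmbed τ X (i,k) (j,k') = δ_{k k'} τ_k (X i j)`.
[folklore] -/
@[simp]
theorem blockEmbed_apply (τ : Fin m → (𝕜 →ₐ[ℝ] ℂ)) (X : Matrix (Fin n) (Fin n) 𝕜) (i j : Fin n)
    (k k' : Fin m) : blockEmbed 𝕜 n m τ X (i, k) (j, k') = if k = k' then τ k (X i j) else 0 :=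
  rfl

/-- The real Lie algebra representation of `𝔤𝔩ₙ(𝕜)` on `ℂ[x_pq : p, q ∈ Fin n × Fin m]`: the
polynomial model of `𝔤𝔩_{Fin n × Fin m}(ℂ)` (as `ℂ`-linear endomorphisms) composed with the
block-diagonal embedding `blockEmbed τ`. [folklore] -/
def blockPolyRep (τ : Fin m → (𝕜 →ₐ[ℝ] ℂ)) :
    Matrix (Fin n) (Fin n) 𝕜 →ₗ⁅ℝ⁆
      Module.End ℂ (MvPolynomial ((Fin n × Fin m) × (Fin n × Fin m)) ℂ) where
  toFun X := glPolyDerivation ℂ (Fin n × Fin m) (blockEmbed 𝕜 n m τ X)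
  map_add' X Y := by
    rw [map_add, glPolyDerivation_add, Derivation.coe_add_linearMap]
  map_smul' c X := by
    rw [map_smul, ← algebraMap_smul ℂ c, glPolyDerivation_smul, Derivation.coe_smul_linearMap,
      algebraMap_smul, RingHom.id_apply]
  map_lie' {X Y} := by
    rw [← AlgHom.toLieHom_apply, LieHom.map_lie, AlgHom.toLieHom_apply, AlgHom.toLieHom_apply,
      glPolyDerivation_lie, Derivation.commutator_coe_linear_map]

/-- `blockPolyRep τ X` is the derivation `D_{blockEmbed τ X}`. [folklore] -/
@[simp]
theorem blockPolyRep_apply (τ : Fin m → (𝕜 →ₐ[ℝ] ℂ)) (X : Matrix (Fin n) (Fin n) 𝕜)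
    (f : MvPolynomial ((Fin n × Fin m) × (Fin n × Fin m)) ℂ) :
    blockPolyRep 𝕜 n m τ X f = glPolyDerivation ℂ (Fin n × Fin m) (blockEmbed 𝕜 n m τ X) f :=
  rfl

variable {𝕜 m}

/-- The nested initial segments `S (k, t) = {(a, t) : a ≤ k}` of the block index set
`Fin n × Fin m` (block `t`, first `k + 1` indices). [folklore] -/
def blockSeg (j : Fin n × Fin m) : Finset (Fin n × Fin m) :=
  Finset.univ.filter fun p => p.2 = j.2 ∧ p.1 ≤ j.1

variable {n} in
/-- Membership in `blockSeg n (k, t)`: same block and index at most `k`. [folklore] -/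
theorem mem_blockSeg {j p : Fin n × Fin m} : p ∈ blockSeg n j ↔ p.2 = j.2 ∧ p.1 ≤ j.1 := by
  simp [blockSeg]

variable {n} in
/-- Summation over `blockSeg n (k, t)` is summation over the indices `a ≤ k` of block `t`.
[folklore] -/
theorem sum_blockSeg {M : Type*} [AddCommMonoid M] (j : Fin n × Fin m) (g : Fin n × Fin m → M) :
    ∑ s ∈ blockSeg n j, g s = ∑ a : Fin n, if a ≤ j.1 then g (a, j.2) else 0 := by
  rw [blockSeg, Finset.sum_filter, Fintype.sum_prod_type]
  refine Finset.sum_congr rfl fun a _ => ?_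
  simp_rw [ite_and]
  rw [Finset.sum_ite_eq' Finset.univ j.2, if_pos (Finset.mem_univ _)]

/-- If the strictly lower triangular part of `X ∈ 𝔤𝔩ₙ(𝕜)` vanishes (e.g. `X` diagonal or strictly
upper triangular), then `blockEmbed τ X` stabilises every coordinate subspace `blockSeg n j`.
[folklore] -/
theorem blockEmbed_blockSeg_eq_zero (τ : Fin m → (𝕜 →ₐ[ℝ] ℂ)) (X : Matrix (Fin n) (Fin n) 𝕜)
    (hX : ∀ i j, j < i → X i j = 0) (j : Fin n × Fin m) :
    ∀ s ∈ blockSeg n j, ∀ r ∉ blockSeg n j, blockEmbed 𝕜 n m τ X r s = 0 := by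
  rintro ⟨s₁, t⟩ hs ⟨r₁, t'⟩ hr
  rw [mem_blockSeg] at hs hr
  rw [blockEmbed_apply]
  split_ifs with h
  · subst h
    have hr₁ : ¬r₁ ≤ j.1 := fun hle => hr ⟨hs.1, hle⟩
    rw [hX r₁ s₁ (lt_of_le_of_lt hs.2 (not_le.mp hr₁)), map_zero]
  · rfl

/-- Diagonal entries of the block-diagonal embedding: `blockEmbed τ X (a,t) (a,t) = τ_t (X a a)`.
[folklore] -/
theorem blockEmbed_apply_same (τ : Fin m → (𝕜 →ₐ[ℝ] ℂ)) (X : Matrix (Fin n) (Fin n) 𝕜)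
    (s : Fin n × Fin m) : blockEmbed 𝕜 n m τ X s s = τ s.2 (X s.1 s.1) := by
  obtain ⟨a, t⟩ := s
  rw [blockEmbed_apply, if_pos rfl]

variable (m) in
/-- The highest weight vector `f_c = ∏_{(k,t)} Δ_{S(k,t)}^{c(k,t)}` of the block polynomial model,
`S (k, t) = blockSeg n (k, t)`. [folklore] -/
def hwPoly (c : Fin n × Fin m → ℕ) : MvPolynomial ((Fin n × Fin m) × (Fin n × Fin m)) ℂ :=
  hwPolyVec ℂ (Fin n × Fin m) (blockSeg n) c

/-- The weight `λ_c` of `f_c` with respect to the enumeration `e` of the embeddings `𝕜 → ℂ`: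
`λ_c τ i = ∑_{k ≥ i} c (k, e τ)`. [folklore] -/
def hwWeight (e : (𝕜 →ₐ[ℝ] ℂ) ≃ Fin m) (c : Fin n × Fin m → ℕ) : ArchWeightGL 𝕜 n :=
  fun τ i => ∑ k : Fin n, if i ≤ k then (c (k, e τ) : ℂ) else 0

/-- The value of the weight `λ_c` on `diag(h)`:
`∑_{τ,i} λ_c τ i · τ(h_i) = ∑_{(k,t)} c(k,t) ∑_{a ≤ k} τ_t(h_a)` for `τ_t = e⁻¹ t`. [folklore] -/
theorem weightFun_hwWeight (e : (𝕜 →ₐ[ℝ] ℂ) ≃ Fin m) (c : Fin n × Fin m → ℕ) (h : Fin n → 𝕜) :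
    weightFun (hwWeight n e c) h =
      ∑ j : Fin n × Fin m, c j • ∑ a : Fin n, if a ≤ j.1 then e.symm j.2 (h a) else 0 := by
  simp only [weightFun, hwWeight]
  rw [Fintype.sum_prod_type, ← e.symm.sum_comp]
  simp only [Equiv.apply_symm_apply, Finset.sum_mul, ite_mul, zero_mul, Finset.smul_sum,
    smul_ite, smul_zero, nsmul_eq_mul]
  conv_rhs => rw [Finset.sum_comm]
  refine Finset.sum_congr rfl fun t _ => ?_
  rw [Finset.sum_comm]

/-- **The highest weight vectors of the block polynomial model.** For every
`c : Fin n × Fin m → ℕ`, `f_c` is a highest weight vector of weight `λ_c`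
(`λ_c τ i = ∑_{k ≥ i} c (k, e τ)`) for `𝔤𝔩ₙ(𝕜)` acting on `ℂ[x_pq : p, q ∈ Fin n × Fin m]` through
`blockPolyRep (e⁻¹)`: `f_c ≠ 0`, strictly upper triangular matrices kill `f_c` (the diagonal
entries of their block-diagonal images vanish), and `diag(h)` acts by
`∑_{(k,t)} c(k,t) ∑_{a ≤ k} τ_t(h_a) = λ_c(diag h)`. This replaces the Verma modules of
Knapp §V.3 in the uniqueness argument. [folklore] -/
theorem isHighestWeightVector_hwPoly (e : (𝕜 →ₐ[ℝ] ℂ) ≃ Fin m) (c : Fin n × Fin m → ℕ) :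
    IsHighestWeightVector (blockPolyRep 𝕜 n m e.symm) (hwWeight n e c) (hwPoly n m c) := by
  refine ⟨hwPolyVec_ne_zero _ _, fun X hX => ?_, fun h => ?_⟩
  · rw [blockPolyRep_apply, hwPoly, glPolyDerivation_hwPolyVec _ _ _ fun j =>
      blockEmbed_blockSeg_eq_zero n e.symm X (fun i j hij => hX i j hij.le) j]
    rw [Finset.sum_eq_zero fun j _ => ?_, zero_smul]
    rw [Finset.sum_eq_zero fun s _ => ?_, smul_zero]
    rw [blockEmbed_apply_same, hX s.1 s.1 le_rfl, map_zero]
  · rw [blockPolyRep_apply, hwPoly, glPolyDerivation_hwPolyVec _ _ _ fun j =>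
      blockEmbed_blockSeg_eq_zero n e.symm _ (fun i j hij => Matrix.diagonal_apply_ne _ hij.ne') j,
      weightFun_hwWeight]
    simp_rw [blockEmbed_apply_same, Matrix.diagonal_apply_eq, sum_blockSeg]

end Assembly

/-! ## Polynomials vanishing at all realised parameters vanish identically -/

section PolyDetermination

/-- A polynomial over an integral domain of characteristic zero that vanishes at every point with
natural number coordinates is zero (the box `ℕ^σ ⊆ R^σ` has infinite sides;
`MvPolynomial.funext_set`). [folklore] -/
theorem mvPolynomial_eq_zero_of_forall_eval_natCast {σ R : Type*} [CommRing R] [IsDomain R]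
    [CharZero R] (p : MvPolynomial σ R)
    (h : ∀ c : σ → ℕ, MvPolynomial.eval (fun s => (c s : R)) p = 0) : p = 0 := by
  refine MvPolynomial.funext_set (fun _ => Set.range (Nat.cast : ℕ → R))
    (fun _ => Set.infinite_range_of_injective Nat.cast_injective) fun x hx => ?_
  choose c hc using Set.mem_univ_pi.mp hx
  obtain rfl : x = fun s => (c s : R) := (funext hc).symm
  rw [map_zero]
  exact h c

variable (n : ℕ)

/-- Every vector is a vector of tail sums: given `u : Fin n → M` there is `y : Fin n → M` with
`u i = ∑_{k ≥ i} y k` for all `i` (take `y k = u k - u (k+1)`, `u n := 0`, and telescope).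
[folklore] -/
theorem exists_eq_sum_ite_le {M : Type*} [AddCommGroup M] (u : Fin n → M) :
    ∃ y : Fin n → M, ∀ i : Fin n, (∑ k : Fin n, if i ≤ k then y k else 0) = u i := by
  let z : ℕ → M := fun j => if h : j < n then u ⟨j, h⟩ else 0
  refine ⟨fun k => z k - z ((k : ℕ) + 1), fun i => ?_⟩
  have h1 : (∑ k : Fin n, if i ≤ k then z k - z ((k : ℕ) + 1) else 0) =
      ∑ k ∈ Finset.range n, if (i : ℕ) ≤ k then z k - z (k + 1) else 0 :=
    Fin.sum_univ_eq_sum_range (fun k => if (i : ℕ) ≤ k then z k - z (k + 1) else 0) n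
  have h2 : (Finset.range n).filter (fun k => (i : ℕ) ≤ k) = Finset.Ico (i : ℕ) n := by
    ext k
    simp [Finset.mem_Ico, and_comm]
  rw [h1, ← Finset.sum_filter, h2, Finset.sum_Ico_eq_sum_range]
  simp_rw [add_assoc]
  rw [Finset.sum_range_sub' (fun k => z (i + k)), add_zero, Nat.add_sub_cancel' i.2.le]
  simp [z, i.2]

variable (𝕜 : Type*) [RCLike 𝕜] (m : ℕ)

/-- **Zariski density of the realised parameters.** A polynomial on `𝔥_ℂ^* = ℂ^{(𝕜 →ₐ[ℝ] ℂ) × Fin n}`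
vanishing at all the points `λ_c + ρ`, `c : Fin n × Fin m → ℕ` (the highest weights of the block
polynomial model shifted by `ρ = rhoGL n`), is zero: its pull-back along the affine substitution
`x_{τ,i} ↦ ∑_{k ≥ i} y_{(k, e τ)} + ρ_i` vanishes on `ℕ^{Fin n × Fin m}`, hence identically, and the
substitution is surjective on `ℂ`-points. (For Knapp, Thm. 5.44, the corresponding step is that a
polynomial on `𝔥_ℂ^*` is determined by its values at all `λ + δ`.) [folklore] -/
theorem eq_zero_of_forall_aeval_hwWeight (e : (𝕜 →ₐ[ℝ] ℂ) ≃ Fin m)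
    (p : MvPolynomial ((𝕜 →ₐ[ℝ] ℂ) × Fin n) ℂ)
    (hp : ∀ c : Fin n × Fin m → ℕ, MvPolynomial.aeval
      (fun q : (𝕜 →ₐ[ℝ] ℂ) × Fin n => hwWeight n e c q.1 q.2 + rhoGL n q.2) p = 0) :
    p = 0 := by
  -- the affine substitution `x_(τ,i) ↦ ∑_{k ≥ i} y_(k, e τ) + ρ_i`
  let g : (𝕜 →ₐ[ℝ] ℂ) × Fin n → MvPolynomial (Fin n × Fin m) ℂ := fun q =>
    (∑ k : Fin n, if q.2 ≤ k then MvPolynomial.X (k, e q.1) else 0) + MvPolynomial.C (rhoGL n q.2)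
  have hg : ∀ (y : Fin n × Fin m → ℂ) (q : (𝕜 →ₐ[ℝ] ℂ) × Fin n), MvPolynomial.aeval y (g q) =
      (∑ k : Fin n, if q.2 ≤ k then y (k, e q.1) else 0) + rhoGL n q.2 := by
    intro y q
    simp [g, apply_ite (MvPolynomial.eval y)]
  -- the pulled-back polynomial vanishes at all `ℕ`-points, hence is zero
  have hq : MvPolynomial.bind₁ g p = 0 := by
    refine mvPolynomial_eq_zero_of_forall_eval_natCast _ fun c => ?_
    rw [← MvPolynomial.aeval_eq_eval, MvPolynomial.aeval_bind₁]
    simp_rw [hg]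
    exact hp c
  -- the substitution is surjective on points, so `p` vanishes everywhere
  refine MvPolynomial.funext fun x => ?_
  rw [map_zero]
  obtain ⟨y, hy⟩ : ∃ y : Fin n × Fin m → ℂ, ∀ q, MvPolynomial.aeval y (g q) = x q := by
    choose Y hY using fun t : Fin m => exists_eq_sum_ite_le n fun i => x (e.symm t, i) - rhoGL n i
    refine ⟨fun kt => Y kt.2 kt.1, fun q => ?_⟩
    rw [hg, hY (e q.1) q.2, Equiv.symm_apply_apply, sub_add_cancel]
  have := congr_arg (MvPolynomial.aeval y) hq
  rw [MvPolynomial.aeval_bind₁, map_zero] at this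
  simp_rw [hy] at this
  exact this

end PolyDetermination

/-! ## Uniqueness of the Harish-Chandra homomorphism -/

section Unique

variable {𝕜 : Type*} [RCLike 𝕜] {n : ℕ}

/-- **Harish-Chandra's theorem for `𝔤𝔩ₙ(𝕜)`, uniqueness** (discharge of the named fact
`harishChandraHomGL_unique`): any two Harish-Chandra homomorphisms `γ₁ γ₂ : HarishChandraHomGL 𝕜 n`
are equal. Both compute the scalar by which `z ∈ Z(𝔤)` acts on the highest weight vectors `f_c`
of the block polynomial model (`isHighestWeightVector_hwPoly`), so `γ₁ z - γ₂ z` vanishes at all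
`λ_c + ρ`, `c : Fin n × Fin m → ℕ`, a Zariski dense set (`eq_zero_of_forall_aeval_hwWeight`);
hence `γ₁.toAlgHom = γ₂.toAlgHom`, and the remaining fields are propositions.
Knapp, *Lie Groups Beyond an Introduction*, 2nd ed. (2002), Ch. V, Thm. 5.44 (uniqueness of `γ`
characterised by (5.43); Knapp evaluates on Verma modules, §V.3, here replaced by polynomial
representations). [cite: Knapp2002, §V.3 and Thm. 5.44] -/
theorem harishChandraHomGL_unique_holds : harishChandraHomGL_unique (𝕜 := 𝕜) (n := n) := by
  rintro ⟨f₁, s₁, h₁⟩ ⟨f₂, s₂, h₂⟩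
  suffices h : f₁ = f₂ by subst h; rfl
  refine AlgHom.ext fun z => ?_
  set m := Fintype.card (𝕜 →ₐ[ℝ] ℂ)
  let e : (𝕜 →ₐ[ℝ] ℂ) ≃ Fin m := Fintype.equivFin _
  rw [← sub_eq_zero]
  refine eq_zero_of_forall_aeval_hwWeight n 𝕜 m e _ fun c => ?_
  have hv := isHighestWeightVector_hwPoly n e c
  have k₁ := h₁ _ (blockPolyRep 𝕜 n m e.symm) (hwWeight n e c) (hwPoly n m c) hv z
  have k₂ := h₂ _ (blockPolyRep 𝕜 n m e.symm) (hwWeight n e c) (hwPoly n m c) hv z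
  rw [k₁] at k₂
  rw [map_sub, sub_eq_zero]
  exact smul_left_injective ℂ hv.1 k₂

end Unique

end Literature.NumberTheory.Automorphic
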